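import Literature.NumberTheory.Automorphic.Liu2021.Def411IrreducibleOfLemD1AsPrinted
import HarnessLib

/-!
# Line `b4-isotropy-rank-three` — hermitian spaces of rank `≥ 3` over the local algebra `E_v = E ⊗_F F_v` are ISOTROPIC
# (fan B, rung B-IV; cell hodgecm-mathlib) — the Mathlib-level input of stable-range non-vanishing in Lem. D.1 (1) at `n ≥ 3`

SKELETON (crux workfile draft).  Serves `stub_isotropic_of_three_le` of the line `b4-lemD1-item1-at-v` (binder `HypD1pp` per
place; also the «`V` is anisotropic (in particular `n = 2`)» parenthetical of [Liu2021, Lem. D.1 (1)]).  WHY THIS LINE: the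
statement is pure algebra of quadratic forms over a non-archimedean local field of characteristic `0` — the u-invariant of a
finite extension of `ℚ_p` is `4` [Lam2005, Ch. VI Thm 2.12 ∕ Cor. 2.15; Serre1973, Ch. IV §2.3 Thm 6 (iii)–(iv) for `ℚ_p`;
Scharlau1985, Ch. 6 §4] — transported to hermitian forms through the TRACE FORM `x ↦ Tr_{E_v/F_v} h(x,x) = 2·h(x,x)`
(rank `2n ≥ 6 ≥ 5`).  No Weil representation, no theta correspondence: a self-contained Mathlib contribution («every quadratic
form in ≥ 5 variables over a p-adic field is isotropic»), provable today from Mathlib's local fields + Hensel.  STRATEGY tag: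
`u-invariant-trace-form` (alternative line, not drafted: `hermitian-classification` via Jacobowitz1962 — hermitian forms over a
local quadratic extension are classified by rank and discriminant norm class, isotropic from rank 2 on when `E_v` is a field
with the right discriminant and always from rank 3).

Stubs `stub_*` are the registered open lemmas; the composition `not_isAnisotropic_localLemD1Data_of` is kernel-checked.
HC_CM is proved only modulo the 7 printed citations until rung 0 closes; nothing here changes that.
-/

set_option autoImplicit false

noncomputable section

open scoped Matrix Kronecker TensorProduct Classical RestrictedProduct
open NumberField NumberField.mixedEmbedding IsDedekindDomain Filter Set
open Literature.NumberTheory.Automorphic Literature.NumberTheory.Automorphic.UnitaryGroup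
open Literature.NumberTheory.Weil1964 Literature.RepresentationTheory
open Literature.RepresentationTheory.HeisenbergGroup
open Literature.GroupTheory.RestrictedProductCharacter
open Literature.NumberTheory Literature.NumberTheory.GelbartRogawski1991 Literature.NumberTheory.GelbartRogawski1991.UnitaryDualPair
open Literature.NumberTheory.GelbartRogawski1991.UnitaryDualPair.WeilCoinv
open Literature.NumberTheory.Automorphic.Liu2021 Literature.NumberTheory.Automorphic.Liu2021.Def411WeilCarriers
open Literature.RepresentationTheory.CentralCharacterQuotient (augmentation quotRep)

namespace HodgecmMathlib.B4.IsotropyRankThree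

variable (F E : Type) [Field F] [NumberField F] [Field E] [NumberField E] [Algebra F E]
variable (c : E ≃ₐ[F] E) (N : ℕ) {n : ℕ} (e : Fin N × Fin 1 ≃ Fin n)
variable (JV : Matrix (Fin N) (Fin N) E) {TV : Matrix (Fin N) (Fin N) F}
variable [Algebra.IsQuadraticExtension F E] {δ : E} (hcδ : c δ = -δ) (hδ : δ ≠ 0) {d : F}
  (hd : δ * δ = algebraMap F E d) (hV : TV.IsSymm) (hVd : IsUnit TV.det) (hJV : JV = TV.map (algebraMap F E))
variable (a : Fˣ)
  (𝓢 : LocalSplitting.FinLocalSplittings F E c n hcδ hδ hd (gram F e TV (TW F a)) (isSymm_gram F e hV (isSymm_TW F a))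
    (reindex_kronecker_eq_gram_map F E e hJV (JW_eq F E a)))
  (hn : 3 ≤ n)
  (μ : ∀ v : HeightOneSpectrum (𝓞 F), (LocalRing E v)ˣ →* ℂˣ) (hμn : ∀ v x, ‖((μ v x : ℂˣ) : ℂ)‖ = 1)
  (hμc : ∀ v, Continuous fun x => ((μ v x : ℂˣ) : ℂ))
  (hμF : ∀ (v : HeightOneSpectrum (𝓞 F)) (t : (v.adicCompletion F)ˣ),
    μ v (Units.map (algebraMap (v.adicCompletion F) (LocalRing E v)).toMonoidHom t) = 1 ↔
      ∃ x : (LocalRing E v)ˣ, (x : LocalRing E v) * conjLocal E c v x = algebraMap (v.adicCompletion F) (LocalRing E v) t)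
  (χ₁ : UnitaryGroup.finAdelicOne F E c →* ℂˣ) (hχ₁n : ∀ u, ‖((χ₁ u : ℂˣ) : ℂ)‖ = 1) (hχ₁c : Continuous χ₁)
  (v : HeightOneSpectrum (𝓞 F))

/-- **stub (L) — the u-invariant of a non-archimedean local field of characteristic `0` is `≤ 4`** [Lam2005, Ch. VI
Thm 2.12; Serre1973, Ch. IV §2.3 Thm 6; Scharlau1985, Ch. 6 Thm 4.?]: every quadratic form over `F_v` on a space of dimension
`≥ 5` has a non-trivial zero (a degenerate form trivially: a radical vector `x` has `2·Q x = polar Q x x = 0`).  Mathlib has: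
`QuadraticMap`, `QuadraticMap.Anisotropic`, `QuadraticMap.polar`, `Module.finrank`, `IsNonarchimedeanLocalField (v.adicCompletion F)`
(used by the tree), Hensel's lemma (`HenselianLocalRing`), finiteness of the residue field; lacks: `F_vˣ/F_vˣ²` is finite of
order `≥ 4` with the Hilbert-symbol pairing, «a non-degenerate ternary form represents every square class `≠ -disc`», and the
classical deduction dim `5 ⇒` isotropic.  Classical chain for the prover: (i) squares: `𝒪_vˣ/𝒪_vˣ²` finite, `|F_vˣ/F_vˣ²| ≥ 4`;
(ii) binary form `⟨1, -a⟩` represents exactly the norms from `F_v(√a)`, an index-2 subgroup for `a` non-square (local CFT-free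
proof: counting with Hensel); (iii) quaternary forms represent everything except that the anisotropic norm form of the
quaternion division algebra misses nothing… — follow [Serre1973, IV.2.2 Cor.] verbatim; (iv) dim 5 = dim 4 ⊥ ⟨e⟩ isotropic.
[cite: Serre1973, Ch. IV §2.3 Thm 6; Lam2005, Ch. VI Thm 2.12] -/
theorem stub_uInvariant_le_four :
    ∀ (M : Type) [AddCommGroup M] [Module (v.adicCompletion F) M] (Q : QuadraticForm (v.adicCompletion F) M),
      5 ≤ Module.finrank (v.adicCompletion F) M → ¬ Q.Anisotropic := by
  sorry

/-- **stub (M) — the TRACE FORM of an anisotropic hermitian space is an anisotropic quadratic form over `F_v`** [Scharlau1985,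
Ch. 10 §1 (transfer ∕ trace forms), MoeglinVignerasWaldspurger1987 Chap. 1 I.1 (the underlying `F`-space `|W|` of an
ε-hermitian `D`-space)]: if the hermitian space `(E_vⁿ, J_V ⊗ (a))` of the local datum is anisotropic then
`x ↦ Tr_{E_v/F_v} h(x, x)` (`= 2·h(x,x)`, as `h(x,x)` is `c`-fixed; `ringChar F_v ≠ 2`, tree `ringChar_adicCompletion_ne_two`)
is an anisotropic `F_v`-quadratic form on the `F_v`-module `Fin n → E_v`.  Mathlib has: `Algebra.trace`, `QuadraticMap` from a
bilinear form (`LinearMap.BilinForm.toQuadraticMap`), `Module.restrictScalars`; tree has: `OscillatorStandingData.form`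
(`hermForm c gram`), `LemD1OfPlace.standingData`, `conjLocal`, `LocalRing E v` as an `F_v`-algebra (`baseChangeEquiv`);
lacks: the sesquilinear-to-`F_v`-bilinear transfer for `hermForm` (write it out: `(x, y) ↦ Tr (h(x,y))`).
[cite: MoeglinVignerasWaldspurger1987, Chap. 1 I.1] -/
theorem stub_traceForm_anisotropic :
    (localLemD1Data F E c N e JV hcδ hδ hd hV hVd hJV a 𝓢 hn μ hμn hμc hμF χ₁ hχ₁n hχ₁c v).IsAnisotropic →
      ∃ Q : QuadraticForm (v.adicCompletion F) (Fin n → LocalRing E v), Q.Anisotropic := by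
  sorry

include hn in
/-- **stub (S∕M) — `dim_{F_v} (E_vⁿ) = 2n ≥ 6`** [CasselsFrohlichANT1967, Ch. II §10 (`L ⊗_K K_v = Π_{w∣v} L_w`, degree `2`)]:
`Module.finrank F_v (Fin n → E_v) ≥ 5`.  Mathlib has: `Module.finrank_pi_fintype` ∕ `Module.finrank_fin_fun`-type lemmas,
`Module.finrank_baseChange` ∕ `Module.finrank_tensorProduct`; tree has: `LemD1OfPlace.baseChangeEquiv : F_v ⊗_F E ≃ₐ[F_v] E_v`,
`Algebra.IsQuadraticExtension.finrank_eq_two`.  Lacks nothing — bookkeeping of instances (`Module.Free`, `Module.Finite` of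
`LocalRing E v` over `F_v`, available via `formallyEtale_localRing` ∕ `isModuleTopology_localRing`'s neighbours).
[cite: CasselsFrohlichANT1967, Ch. II §10] -/
theorem stub_five_le_finrank :
    5 ≤ Module.finrank (v.adicCompletion F) (Fin n → LocalRing E v) := by
  sorry

/-- **COMPOSITION (kernel-checked)**: the hermitian space of the local datum at `v` is ISOTROPIC for `n ≥ 3` — the input
`h₃` of `HodgecmMathlib.B4.LemD1Item1AtV.lemD1_1AsPrintedLocalLemD1Data_of` (line `b4-lemD1-item1-at-v`).
[cite: Liu2021, App. D Lemma D.1 (1) («in particular n = 2»); Serre1973, Ch. IV §2.3 Thm 6] -/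
theorem not_isAnisotropic_localLemD1Data_of
    (hu : ∀ (M : Type) [AddCommGroup M] [Module (v.adicCompletion F) M] (Q : QuadraticForm (v.adicCompletion F) M),
      5 ≤ Module.finrank (v.adicCompletion F) M → ¬ Q.Anisotropic)
    (htr : (localLemD1Data F E c N e JV hcδ hδ hd hV hVd hJV a 𝓢 hn μ hμn hμc hμF χ₁ hχ₁n hχ₁c v).IsAnisotropic →
      ∃ Q : QuadraticForm (v.adicCompletion F) (Fin n → LocalRing E v), Q.Anisotropic)
    (hrk : 5 ≤ Module.finrank (v.adicCompletion F) (Fin n → LocalRing E v)) :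
    ¬ (localLemD1Data F E c N e JV hcδ hδ hd hV hVd hJV a 𝓢 hn μ hμn hμc hμF χ₁ hχ₁n hχ₁c v).IsAnisotropic := by
  intro han
  obtain ⟨Q, hQ⟩ := htr han
  exact hu _ Q hrk hQ

end HodgecmMathlib.B4.IsotropyRankThree

end
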